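import Mathlib
import Literature.MathematicalPhysics.QuantumFieldTheory.BalabanImbrieJaffe1984to88.BIJ85Eq712SymbolCalculus

/-!
# `BalabanImbrieJaffe1984to88.BIJ85Eq712SymbolInverse` — T. Bałaban, J. Imbrie, A. Jaffe, *Renormalization of the Higgs
model: minimizers, propagators and the stability of mean field theory*, Commun. Math. Phys. **97** (1985) 299–329
[BalabanImbrieJaffe1985]: Sect. 7.1 p. 322 — **the inverse rule of the symbol calculus**: a propagator such as `G` in
(7.1.12) `σ_k = η^{−2} − Q^e_k∂G_{k,Ax}∂*Q^{e*}_k`, *"given in the momentum representation"* (p. 322), is the inverse of a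
translation-invariant operator; here, for every translation-invariant operator on a finite torus whose fibres are invertible,
`T⁻¹ = (F⊗1)^*(⊕_p σ_T(p)⁻¹)(F⊗1)` and `σ_{T⁻¹}(p) = σ_T(p)⁻¹`, together with the converse of the diagonalization: EVERY
conjugated fibre operator `(F⊗1)^*(⊕_p B(p))(F⊗1)` is translation invariant with symbol `B` — file 3/3 of the (7.1.2) cluster
(`BIJ85Eq712Plancherel`, `BIJ85Eq712SymbolCalculus`)

statement-level skeleton of published theorems with citation tags; proofs where landed; nothing here is a claim about
the Yang–Mills mass gap

PDF held: `paper:balaban1985-cmp97-bij-higgs-minimizers` (journal page = PDF page + 298).  Text read: PDF p. 24 (journal 322).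

CITATION HEADER (lean-in-tree rule).  Part of the lit-balaban TYPED SKELETON (HOME `run/shared/lean/pub/lit-balaban/`); WHAT IS
REPRODUCED: supporting algebra for SKELETON row **C1.Eq7.1.2-7.1.12** ((7.1.12) p. 322 [PDF 24], verbatim: *"The basic object
we wish to study is σ_k, defined in (4.2.2), σ_k = η^{−2} − Q^e_k∂G_{k,Ax}∂*Q^{e*}_k. (7.1.12) … The operator G_k was given in the
momentum representation in [6I, Eqs. (1.83) and (1.84)]. Starting from this expression, one can derive the following formulas for
σ_k(p) by straightforward, algebraic manipulation"*) of `HOME/lit-balaban-r15/ROWS-C1.md` (owner r15, referee ref-5).  TYPED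
READING: as in `BIJ85Eq712SymbolCalculus` (unit torus `Tor N`, fields `Tor N × m → ℂ`, F⊗1 = `dftC`, `IsTranslInvR`, `symbR`,
`fibreOpR`).  WHAT IS KERNEL-CHECKED (zero `sorry`, standard axioms): `isTranslInvR_fibre` (conjugated fibre operators are
translation invariant), `symbR_fibre` (their symbol is the fibre family — uniqueness of the momentum representation),
`inv_eq_fibre` (`T⁻¹ = (F⊗1)^*(⊕_p σ_T(p)⁻¹)(F⊗1)` when every `det σ_T(p)` is a unit), `IsTranslInv.inv`, **`symb_inv`**
(σ_{T⁻¹} = σ_T⁻¹), `det_fibreOp`, **`det_eq_prod_det_symb`** (det T = ∏_p det σ_T(p)), `isUnit_det_iff` (T invertible ⇔ all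
fibres invertible), `symb_inv_of_isUnit_det`, `IsTranslInv.inv_of_isUnit_det`.  NOT CLAIMED: the symbol of the concrete G_k of (7.1.12) ([6I] (1.83)–(1.84) is the dictionary
`BIJ85MomentumSymbols6I`).  Unit `lit-balaban-p27` (gen 4).
-/

namespace Literature.MathematicalPhysics.QuantumFieldTheory.BalabanImbrieJaffe1984to88.BIJ85Eq712SymbolInverse

open scoped BigOperators Matrix ComplexConjugate
open Finset Complex
open Literature.MathematicalPhysics.QuantumFieldTheory.Balaban1983to89.B5Prop11Plancherel
open Literature.MathematicalPhysics.QuantumFieldTheory.BalabanImbrieJaffe1984to88.BIJ85Eq712Plancherel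
open Literature.MathematicalPhysics.QuantumFieldTheory.BalabanImbrieJaffe1984to88.BIJ85Eq712SymbolCalculus

noncomputable section

variable {d : ℕ} (N : Fin d → ℕ) [hN : ∀ μ, NeZero (N μ)]
variable (m m' : Type*) [Fintype m] [DecidableEq m] [Fintype m'] [DecidableEq m']

/-- kernel: `e^{ip·a} conj(e^{ip·a}) = 1`. [folklore] -/
private theorem chi_mul_conj (p a : Tor N) : chi N p a * conj (chi N p a) = 1 := by
  rw [conj_chi, ← chi_add_left, add_neg_cancel, chi_zero_left]

/-! ## §1 Every conjugated fibre operator is translation invariant, with the fibres as symbol -/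

omit [Fintype m'] [DecidableEq m'] in
/-- kernel: entries of `(F⊗1)^*(⊕_p B(p))`. [folklore] -/
private theorem star_dftC_mul_fibreOpR_apply (B : Tor N → Matrix m m' ℂ) (x : Tor N) (i : m) (q : Tor N) (j : m') :
    (star (dftC N m) * fibreOpR N m m' B) (x, i) (q, j) = conj (dft N q x) * B q i j := by
  rw [Matrix.mul_apply, Fintype.sum_prod_type, Finset.sum_eq_single q]
  · rw [Finset.sum_eq_single i]
    · rw [Matrix.star_apply, dftC_apply, if_pos rfl, Complex.star_def, fibreOpR_apply, if_pos rfl]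
    · intro i' _ hi'
      rw [Matrix.star_apply, dftC_apply, if_neg hi', star_zero, zero_mul]
    · exact fun h => absurd (Finset.mem_univ i) h
  · intro q' _ hq'
    refine Finset.sum_eq_zero fun i' _ => ?_
    rw [fibreOpR_apply, if_neg hq', mul_zero]
  · exact fun h => absurd (Finset.mem_univ q) h

/-- kernel: entries of `(F⊗1)^*(⊕_p B(p))(F⊗1)` — `Σ_q conj F_{q,x} B(q)_{ij} F_{q,y}`. [folklore] -/
private theorem star_dftC_mul_fibreOpR_mul_dftC_apply (B : Tor N → Matrix m m' ℂ) (x y : Tor N) (i : m) (j : m') :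
    (star (dftC N m) * fibreOpR N m m' B * dftC N m') (x, i) (y, j)
      = ∑ q : Tor N, conj (dft N q x) * B q i j * dft N q y := by
  rw [Matrix.mul_apply, Fintype.sum_prod_type]
  refine Finset.sum_congr rfl fun q _ => ?_
  rw [Finset.sum_eq_single j]
  · rw [dftC_apply, if_pos rfl, star_dftC_mul_fibreOpR_apply]
  · intro j' _ hj'
    rw [dftC_apply, if_neg hj', mul_zero]
  · exact fun h => absurd (Finset.mem_univ j) h

/-- kernel: `F_{q,x+a} = F_{q,x} conj(e^{iq·a})`. [folklore] -/
private theorem dft_add_right (q x a : Tor N) : dft N q (x + a) = dft N q x * conj (chi N q a) := by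
  unfold dft
  rw [chi_add_right, map_mul]
  ring

/-- CONVERSELY, every conjugated fibre operator `(F⊗1_m)^*(⊕_p B(p))(F⊗1_{m′})` is translation invariant — so "translation
invariant" and "multiplication operator in the Fourier transform representation" (p. 321) are the same class, closed under the
operations of (7.1.12). [cite: BalabanImbrieJaffe1985, (7.1.12) p.322] -/
theorem isTranslInvR_fibre (B : Tor N → Matrix m m' ℂ) :
    IsTranslInvR N m m' (star (dftC N m) * fibreOpR N m m' B * dftC N m') := by
  intro a x y i j
  rw [star_dftC_mul_fibreOpR_mul_dftC_apply, star_dftC_mul_fibreOpR_mul_dftC_apply]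
  refine Finset.sum_congr rfl fun q _ => ?_
  rw [dft_add_right, dft_add_right, map_mul, Complex.conj_conj]
  linear_combination (conj (dft N q x) * B q i j * dft N q y) * chi_mul_conj N q a

/-- The symbol of `(F⊗1_m)^*(⊕_p B(p))(F⊗1_{m′})` is `B` (uniqueness of the momentum representation).
[cite: BalabanImbrieJaffe1985, (7.1.12) p.322] -/
theorem symbR_fibre (B : Tor N → Matrix m m' ℂ) (p : Tor N) :
    symbR N m m' (star (dftC N m) * fibreOpR N m m' B * dftC N m') p = B p := by
  have h1 := dftC_mul_mul_star N m m' (isTranslInvR_fibre N m m' B)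
  have h2 : dftC N m * (star (dftC N m) * fibreOpR N m m' B * dftC N m') * star (dftC N m') = fibreOpR N m m' B := by
    calc dftC N m * (star (dftC N m) * fibreOpR N m m' B * dftC N m') * star (dftC N m')
        = (dftC N m * star (dftC N m)) * fibreOpR N m m' B * (dftC N m' * star (dftC N m')) := by
          simp only [Matrix.mul_assoc]
      _ = fibreOpR N m m' B := by rw [dftC_mul_star, dftC_mul_star, Matrix.one_mul, Matrix.mul_one]
  exact congrFun (fibreOpR_inj N m m' (h1.symm.trans h2)) p

/-! ## §2 Inverses -/

/-- **INVERSES**: a translation-invariant `T` all of whose fibres `σ_T(p)` are invertible has the inverse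
`T⁻¹ = (F⊗1)^*(⊕_p σ_T(p)⁻¹)(F⊗1)` (how a propagator such as `G` in (7.1.12), the inverse of a translation-invariant
operator, is "given in the momentum representation", p. 322). [cite: BalabanImbrieJaffe1985, (7.1.12) p.322] -/
theorem inv_eq_fibre {T : Matrix (Tor N × m) (Tor N × m) ℂ} (hT : IsTranslInv N m T)
    (hdet : ∀ p, IsUnit (symb N m T p).det) :
    T⁻¹ = star (dftC N m) * fibreOpR N m m (fun p => (symb N m T p)⁻¹) * dftC N m := by
  refine Matrix.inv_eq_right_inv ?_
  have hF : fibreOp N m (symb N m T) * fibreOpR N m m (fun p => (symb N m T p)⁻¹) = 1 := by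
    rw [← fibreOpR_eq_fibreOp, fibreOpR_mul, ← fibreOpR_one]
    congr 1
    funext p
    exact Matrix.mul_nonsing_inv _ (hdet p)
  have hT' := eq_star_dftC_mul_fibreOp_mul_dftC N m hT
  calc T * (star (dftC N m) * fibreOpR N m m (fun p => (symb N m T p)⁻¹) * dftC N m)
      = star (dftC N m) * fibreOp N m (symb N m T) * dftC N m
          * (star (dftC N m) * fibreOpR N m m (fun p => (symb N m T p)⁻¹) * dftC N m) := by rw [← hT']
    _ = star (dftC N m) * (fibreOp N m (symb N m T) * (dftC N m * star (dftC N m))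
          * fibreOpR N m m (fun p => (symb N m T p)⁻¹)) * dftC N m := by simp only [Matrix.mul_assoc]
    _ = 1 := by rw [dftC_mul_star, Matrix.mul_one, hF, Matrix.mul_one, star_dftC_mul]

/-- Inverses of translation-invariant operators with invertible fibres are translation invariant.
[cite: BalabanImbrieJaffe1985, (7.1.12) p.322] -/
theorem IsTranslInv.inv {T : Matrix (Tor N × m) (Tor N × m) ℂ} (hT : IsTranslInv N m T)
    (hdet : ∀ p, IsUnit (symb N m T p).det) : IsTranslInv N m T⁻¹ := by
  rw [inv_eq_fibre N m hT hdet]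
  exact isTranslInvR_fibre N m m _

/-- **THE INVERSE RULE** `σ_{T⁻¹}(p) = σ_T(p)⁻¹` (all fibres invertible). [cite: BalabanImbrieJaffe1985, (7.1.12) p.322] -/
theorem symb_inv {T : Matrix (Tor N × m) (Tor N × m) ℂ} (hT : IsTranslInv N m T)
    (hdet : ∀ p, IsUnit (symb N m T p).det) (p : Tor N) : symb N m T⁻¹ p = (symb N m T p)⁻¹ := by
  rw [inv_eq_fibre N m hT hdet, ← symbR_eq_symb]
  exact symbR_fibre N m m _ p

/-! ## §3 Determinant and invertibility in the momentum representation -/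

/-- `det (⊕_p B(p)) = ∏_p det B(p)`. [cite: BalabanImbrieJaffe1985, (7.1.12) p.322] -/
theorem det_fibreOp (B : Tor N → Matrix m m ℂ) : (fibreOp N m B).det = ∏ p, (B p).det := by
  have h : fibreOp N m B
      = (Matrix.blockDiagonal B).submatrix (Equiv.prodComm (Tor N) m) (Equiv.prodComm (Tor N) m) := by
    ext ⟨a, i⟩ ⟨b, j⟩
    rw [fibreOp_apply, Matrix.submatrix_apply, Equiv.prodComm_apply, Equiv.prodComm_apply, Prod.swap_prod_mk,
      Prod.swap_prod_mk, Matrix.blockDiagonal_apply]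
  rw [h, Matrix.det_submatrix_equiv_self, Matrix.det_blockDiagonal]

/-- **`det T = ∏_p det σ_T(p)`** for a translation-invariant `T` (the conjugating `F⊗1` is unitary).
[cite: BalabanImbrieJaffe1985, (7.1.12) p.322] -/
theorem det_eq_prod_det_symb {T : Matrix (Tor N × m) (Tor N × m) ℂ} (hT : IsTranslInv N m T) :
    T.det = ∏ p, (symb N m T p).det := by
  have h := eq_star_dftC_mul_fibreOp_mul_dftC N m hT
  calc T.det = (star (dftC N m) * fibreOp N m (symb N m T) * dftC N m).det := by rw [← h]
    _ = ∏ p, (symb N m T p).det := by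
        rw [Matrix.det_mul, Matrix.det_mul, mul_right_comm, ← Matrix.det_mul, star_dftC_mul, Matrix.det_one,
          one_mul, det_fibreOp]

/-- A translation-invariant operator is invertible iff EVERY fibre `σ_T(p)` is (so the inverse rule applies to an operator
known to be invertible in configuration space, such as the propagators entering (7.1.12)).
[cite: BalabanImbrieJaffe1985, (7.1.12) p.322] -/
theorem isUnit_det_iff {T : Matrix (Tor N × m) (Tor N × m) ℂ} (hT : IsTranslInv N m T) :
    IsUnit T.det ↔ ∀ p, IsUnit (symb N m T p).det := by
  simp_rw [isUnit_iff_ne_zero, det_eq_prod_det_symb N m hT, Finset.prod_ne_zero_iff, Finset.mem_univ, true_imp_iff]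

/-- The inverse rule from configuration-space invertibility: `det T` a unit ⇒ `σ_{T⁻¹}(p) = σ_T(p)⁻¹`.
[cite: BalabanImbrieJaffe1985, (7.1.12) p.322] -/
theorem symb_inv_of_isUnit_det {T : Matrix (Tor N × m) (Tor N × m) ℂ} (hT : IsTranslInv N m T)
    (hdet : IsUnit T.det) (p : Tor N) : symb N m T⁻¹ p = (symb N m T p)⁻¹ :=
  symb_inv N m hT ((isUnit_det_iff N m hT).1 hdet) p

/-- … and `T⁻¹` is again translation invariant. [cite: BalabanImbrieJaffe1985, (7.1.12) p.322] -/
theorem IsTranslInv.inv_of_isUnit_det {T : Matrix (Tor N × m) (Tor N × m) ℂ} (hT : IsTranslInv N m T)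
    (hdet : IsUnit T.det) : IsTranslInv N m T⁻¹ :=
  IsTranslInv.inv N m hT ((isUnit_det_iff N m hT).1 hdet)

end

end Literature.MathematicalPhysics.QuantumFieldTheory.BalabanImbrieJaffe1984to88.BIJ85Eq712SymbolInverse
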